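import Summits.QuantumFields.YangMills.Theorems.BalabanUVNodesN22W1RelCentredJointNumerals
import Summits.QuantumFields.YangMills.Theorems.BalabanUVNodesN22W1RelCentredDatumKnitL2U
import Summits.QuantumFields.YangMills.Theorems.BalabanUVNodesN22W1RelCentredSliceInputsL2UWitness
import Literature.MathematicalPhysics.QuantumFieldTheory.Balaban1983to89.Node00.Record13CoPH

/-!
# BalabanUVNodes ∕ node N22 = NE9 — THE RELATIVE-DISC CENTRED ROAD, WIDTH-SEAT NOTE W2-1: THE KNIT's NUMERALS ∧ ITS LOCATED INPUTS ARE JOINTLY SATISFIABLE AT A WINDOW `γ`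
# IFF `γ² < ½` — the small-field located record forces `Mv > 1` (necessity), module J14's numerals SHARPENED from `γ ≤ ½` to every `γ² < ½` (sufficiency), and what the
# record's admissibility says about the window of a Stage-13 tuple (`0 < θ.γ < 1`, no more)

Cell `pub-ymgap`, HUMAN RULING D-0062 (Track A) ∕ D-0149 (work-bound push, director-ym №197), WIDTH SEAT `pub-ymgap-dag-n22-w2` (generation 0), plan g77 `W-SEAT-START-LIST` § n22 item 2
«the NUMERALS' JOINT SATISFIABILITY at the datum of record … A6-decisive for the J-road».  THEOREMS ONLY; imports module J14 `…JointNumerals` (`lemma3Numerics_consts_anyM_fifth`,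
`consts_α₆_ne_zero`; through it R4s ∕ R4 ∕ module 17 ∕ dag-n18-c's strict [KP86] clause ∕ `B13Lemma3TorusNonvacuity`), module J17-K `…DatumKnitL2U` (the knit over the Lemma-2-sentence
located inputs; through it J17-D `SliceInputsL2U`) and node00-def-T's `Node00/Record13CoPH` (`Stage13HParams`) BY NAME.  `--supports` K3⁷ `SpineGivenEndpointR13SepCoPH`
(stmt-QuantumFields-20544) as a helper.

WHY.  Module J17-K (the s1 line's end state at N22) displays, per Stage-13 tuple `θ` and run length `k`, (a) the capstone ∕ aperture NUMERALS — among them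
`hMvγ : (1−cP)⁻²·Mv·((1+cA)·θ.γ)² ≤ ½` with `0 < cA < cP < 1`, `0 < Mv` — and (b) the LOCATED INPUTS `ιL2`: one `SliceInputsL2U … s₀ a a₅ ρb Mv` record per slice `(k′ < k, X, Z ⊆ X,
t ∈ terms, s₀ ∈ ]0, θ.γ])`, with the SAME vertex letter `Mv`.  Module J14 showed (a) satisfiable at `c := consts` for windows `γ ≤ ½` (`Mv := 3∕2`); module J17-W showed (b) inhabited
(degenerate data) for every `Mv > 1`.  Two facts were not in the tree: (i) `Mv > 1` is not a choice but FORCED by (b) — on a small-field label `P(t) = ∅` the record's box-tail rate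
`hRb : e^{−κRb²∕2} ≤ T·s₀²` makes `T > 0` and `hMvT : 1 + T ≤ Mv` makes `Mv > 1`; with (a) this forces `θ.γ² < ½` (`γ < 1∕√2 ≈ 0.7071`); (ii) conversely (a) IS satisfiable, jointly with
J17-W's letters `a₅ = 1∕5`, `ρb = 1∕100` and some `Mv > 1`, at EVERY window `γ² < ½` — not only `γ ≤ ½`.  So the joint satisfiability of the J-road's antecedent at a tuple of record is
DECIDED by the window: yes iff `θ.γ² < ½`.  The record's admissibility (`Stage5Params.Admissible`: `0 < γ`; `Stage12Params.Pos₁₂`: `γ < 1`) displays `0 < θ.γ < 1` and nothing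
sharper (print: γ «sufficiently small», [I] p. 263, [B16] Thm 1 — a smallness the record does not carry as a numeral).

WHAT.  §1 NECESSITY: `sq_lt_half_of_apertureNumeral` (`1 < Mv`, `0 ≤ cA`, `0 ≤ cP < 1`, `hMvγ` ⇒ `γ² < ½`), `not_exists_apertureNumeral_of_half_le_sq` (sharpness),
`exists_smallField_slice` (every step `k′` HAS a small-field slice: the one-cube family `({Y}, ∅)` under its closure `Z = Y′`), `SliceInputsL2U.T_pos_of_smallField`,
★ `SliceInputsL2U.one_lt_Mv_of_smallField` (any inhabitant of J17-D's record at `P(t) = ∅` has `1 < Mv`), `SliceInputsL2U.basePoint_ne_zero_of_smallField`,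
★ `sq_window_lt_half_of_knitLocatedInputs` (J17-K's binder `ιL2` at run length `k ≥ 1` + the aperture numerals ⇒ `γ² < ½`) and its contrapositive
★ `knitLocatedInputs_isEmpty_of_half_le_sq` (at `½ ≤ γ²`, `k ≥ 1`, the binder type `ιL2` is EMPTY), and the same in module J19's `Nonempty` currency:
`sq_window_lt_half_of_keyedLocatedInputs`, ★ `not_keyedLocatedInputs_of_half_le_sq` (J19's `hdata` unsatisfiable at `½ ≤ θ.γ²`, `ksel ≥ 1`).  §2 SUFFICIENCY: `apertureArith_of_window` (the polynomial arithmetic),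
★ `knitNumerals_consts_at_window_keyed` — for every `M` and every window `γ² < ½`, AT THE NAMED LETTERS `cP = (½ − γ²)∕100`, `cA = (½ − γ²)∕200`, `Mv = 1 + (½ − γ²)∕100`,
`li = ⟨consts.κ, ½, 0, 0, 0, 1, 7, 1, cA, 2⁻¹⟩` (equation binders, `rfl`-instantiable by a θ-dependent consumer): EVERY numeric hypothesis of J17-K at `c := consts`, `a₅ := 1∕5`,
`ρb := 1∕100` ∧ `1 < Mv` ∧ `1 ≤ consts.κ₁` ∧ `consts.α₆ ≠ 0` ∧ W1-8's `invTau` window; ★ `knitNumerals_consts_at_window` (module J14's `∃`-shape, window `γ² < ½` instead of `γ ≤ ½`).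
§3 AT A TUPLE OF RECORD: `sq_window_lt_half_of_le_half` (`0 ≤ γ ≤ ½ ⇒ γ² < ½`, J14's ∕ J21's regime), `stage13_admissible_window` (`θ.Admissible F N → 0 < θ.γ ∧ θ.γ < 1` — the record's whole word on the window), ★ `knitNumerals_consts_at_admissible_tuple` (`0 < θ.γ` and
the letters at `M := θ.τ9.M`, `γ := θ.γ` for every admissible `θ : Stage13HParams F N` with `θ.γ² < ½`), `exists_apertureNumeral_iff_sq_window_lt_half` (the dichotomy per tuple).

HONEST FRAMING — LOCATED finding «WINDOW-N22-J» (A6-class, count-neutral).  Arithmetic and kernel bookkeeping at the letters; no estimate of Bałaban's is proved or asserted; N22 NOT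
discharged (typed 28∕28 · discharged 5∕27 UNCHANGED); no inhabitant of any record key is claimed (K0 OPEN) — in particular NO admissible tuple with provisos and `θ.γ ≥ 1∕√2` is
exhibited here (whether the provisos exclude such windows is the definers' word); the repair, if one is wanted — a window numeral on the record side, or an `Mv`-free aperture in the
knit — is NOT chosen here.  One finite four-torus programme at fixed ε — R4 closes the conditional rung `BalabanLadder.UV` only; NOT infinite volume, NOT OS on ℝ⁴, NOT a mass gap, NOT
Clay.  0 `sorry`, 0 `def`, standard axioms.

References (TYPES ∕ loci only): [II] = [Balaban1988RG2Cluster] (2.3) p. 12, (2.9) p. 14, (2.14)–(2.15) p. 15, (2.22) p. 16, (2.24)–(2.26) p. 17, Lemma 3 p. 20, (2.39)–(2.41) p. 21;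
[I] = [Balaban1987RG1] §1 p. 263, (2.9)–(2.10) pp. 266–267; [III] = [Balaban1988Convergent] (2.10) p. 256; [B16] = [Balaban1989LargeFieldII] Thm 1 p. 355.
-/

noncomputable section

namespace YMDAG.N22.W1

open Set Metric
open scoped BigOperators
open Literature.MathematicalPhysics.QuantumFieldTheory.Balaban1983to89
open Literature.MathematicalPhysics.QuantumFieldTheory.Balaban1983to89.T4Continuum (T4Family)
open Literature.MathematicalPhysics.QuantumFieldTheory.Balaban1983to89.TreeLengthTorus (TPt TDom tsys)
open Literature.MathematicalPhysics.QuantumFieldTheory.Balaban1983to89.TreeLengthTorusTransfer (tclosure tclosureDom tclosureDom_val)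
open Literature.MathematicalPhysics.QuantumFieldTheory.Balaban1983to89.B12TreeDecay (K₀)
open Literature.MathematicalPhysics.QuantumFieldTheory.Balaban1983to89.B13Lemma3TorusTerms (terms mem_terms IsTerm Z0 Y0 cubesP)
open Literature.MathematicalPhysics.QuantumFieldTheory.Balaban1983to89.B13Lemma3TorusSocket (Lemma3Numerics)
open Literature.MathematicalPhysics.QuantumFieldTheory.Balaban1983to89.B13Lemma3WindowNonvacuity (aw)
open Literature.MathematicalPhysics.QuantumFieldTheory.Balaban1983to89.B13Lemma3TorusNonvacuity (consts numerics_nonvacuous_pos_consts)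
open Literature.MathematicalPhysics.QuantumFieldTheory.Balaban1983to89.B13Bound143 (invTau)
open Literature.MathematicalPhysics.QuantumFieldTheory.Balaban1983to89.Step (SFConsts)
open Literature.MathematicalPhysics.QuantumFieldTheory.Balaban1983to89.Node00 (Stage13Params Stage13HParams)
open Literature.MathematicalPhysics.QuantumFieldTheory.Balaban1983to89.Node00.Sect2 (domSys domCount CPair Setting Residual)
open Literature.MathematicalPhysics.QuantumFieldTheory.Balaban1983to89.Node00.W1
open Summit.QuantumFields.YangMills.BalabanUVNodes.N18HLayerW1NumeralsStrict (smallKP_consts_strict)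

/-! ## §1 Necessity: a small-field located record forces `Mv > 1`; the aperture numeral then forces `γ² < ½` -/

/-- **THE APERTURE NUMERAL WITH `Mv > 1` FORCES `γ² < ½`**: `(1−cP)⁻² ≥ 1` (`0 ≤ cP < 1`) and `(1+cA)² ≥ 1` (`0 ≤ cA`), so `Mv·γ² ≤ (1−cP)⁻²·Mv·((1+cA)γ)² ≤ ½`, and `Mv > 1`
gives `γ² < ½` (`γ < 1∕√2`). [cite: Balaban1987RG1, §1 p.263 (the window ]0, γ]); Balaban1988RG2Cluster, (2.24)-(2.26) p.17 (bookkeeping at the letters)] -/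
theorem sq_lt_half_of_apertureNumeral {γ cA cP Mv : ℝ} (hMv : 1 < Mv) (hcA : 0 ≤ cA) (hcP : 0 ≤ cP) (hcP1 : cP < 1)
    (h : (1 - cP)⁻¹ ^ 2 * Mv * ((1 + cA) * γ) ^ 2 ≤ 1 / 2) : γ ^ 2 < 1 / 2 := by
  have hP : 1 ≤ (1 - cP)⁻¹ := one_le_inv_iff₀.2 ⟨by linarith, by linarith⟩
  have hP2 : 1 ≤ (1 - cP)⁻¹ ^ 2 := by nlinarith
  have hA2 : 1 ≤ (1 + cA) ^ 2 := by nlinarith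
  have hPA : 1 ≤ (1 - cP)⁻¹ ^ 2 * (1 + cA) ^ 2 := one_le_mul_of_one_le_of_one_le hP2 hA2
  have hMγ : 0 ≤ Mv * γ ^ 2 := mul_nonneg (by linarith) (sq_nonneg γ)
  have hle : Mv * γ ^ 2 ≤ 1 / 2 :=
    calc Mv * γ ^ 2 ≤ ((1 - cP)⁻¹ ^ 2 * (1 + cA) ^ 2) * (Mv * γ ^ 2) := le_mul_of_one_le_left hMγ hPA
      _ = (1 - cP)⁻¹ ^ 2 * Mv * ((1 + cA) * γ) ^ 2 := by ring
      _ ≤ 1 / 2 := h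
  nlinarith [sq_nonneg γ]

/-- **SHARPNESS OF THE WINDOW**: at `½ ≤ γ²` NO aperture letters `0 ≤ cA`, `0 ≤ cP < 1`, `1 < Mv` meet the knit's aperture numeral.
[cite: Balaban1987RG1, §1 p.263 (the window); Balaban1988RG2Cluster, (2.24)-(2.26) p.17 (bookkeeping)] -/
theorem not_exists_apertureNumeral_of_half_le_sq {γ : ℝ} (hγ2 : 1 / 2 ≤ γ ^ 2) :
    ¬ ∃ cA cP Mv : ℝ, 0 ≤ cA ∧ 0 ≤ cP ∧ cP < 1 ∧ 1 < Mv ∧ (1 - cP)⁻¹ ^ 2 * Mv * ((1 + cA) * γ) ^ 2 ≤ 1 / 2 := by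
  rintro ⟨cA, cP, Mv, hcA, hcP, hcP1, hMv, h⟩
  have := sq_lt_half_of_apertureNumeral hMv hcA hcP hcP1 h
  linarith

/-- **EVERY STEP HAS A SMALL-FIELD SLICE**: for every `k′` there are `X = Z ∈ 𝐃_{k′+1}` and a term `t = ({Y}, ∅) ∈ terms L M Z` with `P(t) = ∅` — `Y` the one-cube domain of the
fine catalogue at the origin, `Z := Y′` its closure ([II] p. 19), so that `Z₀(t) = Y`, `Z′₀ = Z`.  (Non-vacuity of the small-field block of the knit's `ιL2`.)
[cite: Balaban1988RG2Cluster, (2.1)-(2.3) p.12, (2.9) p.14 and p.19 (Z′); bookkeeping] -/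
theorem exists_smallField_slice (P : Params) (M k' L : ℕ) [NeZero M] [NeZero L] :
    ∃ (X Z : (domSys P M (k' + 1)).Dom) (_ : Z.1 ⊆ X.1) (t : TermLabel P M k' L), t ∈ terms L M Z ∧ t.2 = ∅ := by
  classical
  -- the one-cube domain of the fine catalogue at the origin
  let Y : TDom P.d (L * domCount P M (k' + 1)) :=
    ⟨{fun _ => 0}, Finset.singleton_nonempty _, fun a ha b hb => by
      rw [Finset.mem_singleton] at ha hb
      subst ha; subst hb
      exact Relation.ReflTransGen.refl⟩
  have hZ0 : Z0 M (({Y}, ∅) : TermLabel P M k' L) = Y.1 := by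
    simp [Z0, Y0, cubesP]
  refine ⟨tclosureDom L (domCount P M (k' + 1)) Y, tclosureDom L (domCount P M (k' + 1)) Y, subset_rfl, ({Y}, ∅), ?_, rfl⟩
  rw [mem_terms]
  unfold IsTerm
  refine ⟨fun b hb => absurd hb (Finset.notMem_empty b), ?_, ?_⟩
  · rw [hZ0]; exact Y.2.1
  · rw [hZ0]; exact Finset.subset_of_eq (tclosureDom_val Y).symm

section Necessity

variable {c₀ : B13.Consts} {P : Params} {𝔸 : Type*} [NormedRing 𝔸] [NormedAlgebra ℂ 𝔸] [CompleteSpace 𝔸] {M k L : ℕ} [NeZero L]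
  {𝔇 : TermDatum214 c₀ P 𝔸 M k L} {χu χcu : 𝔇.UnscaledChi} {𝒲 : 𝔇.UnscaledWilson} {𝒪 : 𝔇.UnscaledOlder}
  {c : B13.Consts} {G : Type*} [GaugeGroup G] {Sg : Setting 𝔸 G} {Rz : Residual P 𝔸} {cs : SFConsts} {E₀ κE : ℝ}
  {Z : (domSys P M (k + 1)).Dom} {t : TermLabel P M k L} {W : Set (CPair P 𝔸)} {s₀ a a₅ ρb Mv : ℝ}

/-- **THE BOX-TAIL LETTER IS POSITIVE ON A SMALL-FIELD LABEL**: for any inhabitant of J17-D's located record at a label with `P(t) = ∅`, the box-tail rate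
`hRb : e^{−κRb²∕2} ≤ T·s₀²` forces `0 < T` (an exponential is positive). [cite: Balaban1988RG2Cluster, (2.3) p.12 and (2.22) p.16 (the boxes; bookkeeping at the letters)] -/
theorem SliceInputsL2U.T_pos_of_smallField (I : SliceInputsL2U 𝔇 χu χcu 𝒲 𝒪 c Sg Rz cs E₀ κE Z t W s₀ a a₅ ρb Mv) (ht : t.2 = ∅) : 0 < I.T := by
  have h1 := I.hRb ht
  have h2 := Real.exp_pos (-(I.κ / 2 * I.Rb ^ 2))
  by_contra hT
  have hT' : I.T ≤ 0 := not_lt.1 hT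
  nlinarith [sq_nonneg s₀]

/-- **★ A SMALL-FIELD LOCATED RECORD FORCES `Mv > 1`**: for any inhabitant of J17-D's `SliceInputsL2U … s₀ a a₅ ρb Mv` at a label with `P(t) = ∅`, `1 < Mv` — by `hMvT : 1 + T ≤ Mv`
and `0 < T` (`T_pos_of_smallField`).  The vertex letter of the knit is therefore NEVER `≤ 1` once a small-field slice is asked.
[cite: Balaban1988RG2Cluster, (2.3) p.12, (2.22) p.16 and (2.24)-(2.26) p.17 (bookkeeping at the letters)] -/
theorem SliceInputsL2U.one_lt_Mv_of_smallField (I : SliceInputsL2U 𝔇 χu χcu 𝒲 𝒪 c Sg Rz cs E₀ κE Z t W s₀ a a₅ ρb Mv) (ht : t.2 = ∅) : 1 < Mv := by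
  have h1 := I.T_pos_of_smallField ht
  have h2 := I.hMvT ht
  linarith

/-- **… AND ITS BASE POINT IS NONZERO** (the same inequality: `T·s₀² > 0`). [cite: Balaban1988RG2Cluster, (2.22) p.16 (bookkeeping at the letters)] -/
theorem SliceInputsL2U.basePoint_ne_zero_of_smallField (I : SliceInputsL2U 𝔇 χu χcu 𝒲 𝒪 c Sg Rz cs E₀ κE Z t W s₀ a a₅ ρb Mv) (ht : t.2 = ∅) : s₀ ≠ 0 := by
  intro hs
  have h1 := I.hRb ht
  have h2 := Real.exp_pos (-(I.κ / 2 * I.Rb ^ 2))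
  have h3 : s₀ ^ 2 = 0 := by rw [hs]; ring
  rw [h3, mul_zero] at h1
  linarith

end Necessity

section KnitLevel

variable (c : B13.Consts) (P : Params) (𝔸 : Type*) [NormedRing 𝔸] [NormedAlgebra ℂ 𝔸] [CompleteSpace 𝔸] (M L : ℕ) [NeZero M] [NeZero L]
  (𝔇 : TermData214 c P 𝔸 M L) (χu χcu : (k : ℕ) → (𝔇 k).UnscaledChi) (𝒲 : (k : ℕ) → (𝔇 k).UnscaledWilson) (𝒪 : (k : ℕ) → (𝔇 k).UnscaledOlder)
  {G : Type*} [GaugeGroup G] (Sg : Setting 𝔸 G) (Rz : Residual P 𝔸) (cs : SFConsts) (E₀ κE a a₅ ρb Mv : ℝ)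
  (Wt : (k' : ℕ) → (domSys P M (k' + 1)).Dom → Set (CPair P 𝔸)) (γ : ℝ) (k : ℕ)

/-- **★ THE KNIT's LOCATED INPUTS AND ITS APERTURE NUMERAL FORCE `γ² < ½`**: module J17-K's binder `ιL2` (one `SliceInputsL2U` record per slice `k′ < k`, `Z ⊆ X`, `t ∈ terms`,
`s₀ ∈ ]0, γ]`, the SAME `Mv`) at a run length `k ≥ 1`, a positive window `0 < γ`, and its aperture binders `0 ≤ cA ≤ cP < 1` (J17-K: `hc0 hcAP hcP1`, strict), `hMvγ` TOGETHER give
`γ² < ½`: read `ιL2` at the small-field slice of `exists_smallField_slice` (step `0`) at `s₀ := γ`, then `one_lt_Mv_of_smallField` and `sq_lt_half_of_apertureNumeral`.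
[cite: Balaban1988RG2Cluster, (2.3) p.12, (2.9) p.14, (2.22) p.16, (2.24)-(2.26) p.17; Balaban1987RG1, §1 p.263 (bookkeeping at the letters)] -/
theorem sq_window_lt_half_of_knitLocatedInputs (hk : 1 ≤ k) (hγ : 0 < γ) {cA cP : ℝ} (hc0 : 0 ≤ cA) (hcAP : cA ≤ cP) (hcP1 : cP < 1)
    (hMvγ : (1 - cP)⁻¹ ^ 2 * Mv * ((1 + cA) * γ) ^ 2 ≤ 1 / 2)
    (ιL2 : ∀ k' : ℕ, k' < k → ∀ (X Z : (domSys P M (k' + 1)).Dom), Z.1 ⊆ X.1 → ∀ t ∈ terms L M Z, ∀ s₀ ∈ Ioc (0 : ℝ) γ,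
      SliceInputsL2U (𝔇 k') (χu k') (χcu k') (𝒲 k') (𝒪 k') c Sg Rz cs E₀ κE Z t (Wt k' X) s₀ a a₅ ρb Mv) :
    γ ^ 2 < 1 / 2 := by
  obtain ⟨X, Z, hZ, t, ht, ht0⟩ := exists_smallField_slice P M 0 L
  have I := ιL2 0 (by omega) X Z hZ t ht γ ⟨hγ, le_rfl⟩
  exact sq_lt_half_of_apertureNumeral (I.one_lt_Mv_of_smallField ht0) hc0 (hc0.trans hcAP) hcP1 hMvγ

/-- **★ AT `½ ≤ γ²` THE KNIT's ANTECEDENT IS UNINHABITED** (contrapositive): for a run length `k ≥ 1`, a window `0 < γ` with `½ ≤ γ²` and aperture letters `0 ≤ cA ≤ cP < 1`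
meeting `hMvγ`, the located-input binder type `ιL2` of J17-K is EMPTY — the knit cannot fire at such a window, whatever the datum, the thickening, the tables, the other numerals or
N18 below.  LOCATED «WINDOW-N22-J»; no tuple of record is exhibited here. [cite: Balaban1987RG1, §1 p.263; Balaban1988RG2Cluster, (2.24)-(2.26) p.17 (bookkeeping)] -/
theorem knitLocatedInputs_isEmpty_of_half_le_sq (hk : 1 ≤ k) (hγ : 0 < γ) (hγ2 : 1 / 2 ≤ γ ^ 2) {cA cP : ℝ} (hc0 : 0 ≤ cA) (hcAP : cA ≤ cP) (hcP1 : cP < 1)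
    (hMvγ : (1 - cP)⁻¹ ^ 2 * Mv * ((1 + cA) * γ) ^ 2 ≤ 1 / 2) :
    IsEmpty (∀ k' : ℕ, k' < k → ∀ (X Z : (domSys P M (k' + 1)).Dom), Z.1 ⊆ X.1 → ∀ t ∈ terms L M Z, ∀ s₀ ∈ Ioc (0 : ℝ) γ,
      SliceInputsL2U (𝔇 k') (χu k') (χcu k') (𝒲 k') (𝒪 k') c Sg Rz cs E₀ κE Z t (Wt k' X) s₀ a a₅ ρb Mv) :=
  ⟨fun ιL2 => absurd (sq_window_lt_half_of_knitLocatedInputs c P 𝔸 M L 𝔇 χu χcu 𝒲 𝒪 Sg Rz cs E₀ κE a a₅ ρb Mv Wt γ k hk hγ hc0 hcAP hcP1 hMvγ ιL2)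
    (not_lt.2 hγ2)⟩

/-- **THE SAME IN MODULE J19's `Nonempty` CURRENCY** (the keyed CoPH storey's `hdata` asks, below the selected run length, `Nonempty (SliceInputsL2U …)` per slice, with the
numerals' OWN `cA cP Mv`): a run length `k ≥ 1`, `0 < γ`, `0 ≤ cA ≤ cP < 1`, `hMvγ` and the `Nonempty` binder give `γ² < ½`.
[cite: Balaban1988RG2Cluster, (2.3) p.12, (2.9) p.14, (2.22) p.16, (2.24)-(2.26) p.17; Balaban1987RG1, §1 p.263 (bookkeeping at the letters)] -/
theorem sq_window_lt_half_of_keyedLocatedInputs (hk : 1 ≤ k) (hγ : 0 < γ) {cA cP : ℝ} (hc0 : 0 ≤ cA) (hcAP : cA ≤ cP) (hcP1 : cP < 1)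
    (hMvγ : (1 - cP)⁻¹ ^ 2 * Mv * ((1 + cA) * γ) ^ 2 ≤ 1 / 2)
    (ιN : ∀ k' : ℕ, k' < k → ∀ (X Z : (domSys P M (k' + 1)).Dom), Z.1 ⊆ X.1 → ∀ t ∈ terms L M Z, ∀ s₀ ∈ Ioc (0 : ℝ) γ,
      Nonempty (SliceInputsL2U (𝔇 k') (χu k') (χcu k') (𝒲 k') (𝒪 k') c Sg Rz cs E₀ κE Z t (Wt k' X) s₀ a a₅ ρb Mv)) :
    γ ^ 2 < 1 / 2 := by
  obtain ⟨X, Z, hZ, t, ht, ht0⟩ := exists_smallField_slice P M 0 L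
  obtain ⟨I⟩ := ιN 0 (by omega) X Z hZ t ht γ ⟨hγ, le_rfl⟩
  exact sq_lt_half_of_apertureNumeral (I.one_lt_Mv_of_smallField ht0) hc0 (hc0.trans hcAP) hcP1 hMvγ

/-- **★ J19's `hdata` IS UNSATISFIABLE AT `½ ≤ γ²` BELOW ANY SELECTED RUN LENGTH `≥ 1`**: with `0 < γ`, `½ ≤ γ²`, `0 ≤ cA ≤ cP < 1` and `hMvγ`, the per-slice `Nonempty (SliceInputsL2U …)`
binder of the keyed CoPH storey FAILS — so at a Stage-13 tuple of record with `θ.γ ∈ [1∕√2, 1)` (not excluded by admissibility, §3) the storey's antecedent is uninhabited whenever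
`ksel ≥ 1`.  LOCATED «WINDOW-N22-J»; no tuple of record is exhibited here. [cite: Balaban1987RG1, §1 p.263; Balaban1988RG2Cluster, (2.24)-(2.26) p.17 (bookkeeping)] -/
theorem not_keyedLocatedInputs_of_half_le_sq (hk : 1 ≤ k) (hγ : 0 < γ) (hγ2 : 1 / 2 ≤ γ ^ 2) {cA cP : ℝ} (hc0 : 0 ≤ cA) (hcAP : cA ≤ cP) (hcP1 : cP < 1)
    (hMvγ : (1 - cP)⁻¹ ^ 2 * Mv * ((1 + cA) * γ) ^ 2 ≤ 1 / 2) :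
    ¬ ∀ k' : ℕ, k' < k → ∀ (X Z : (domSys P M (k' + 1)).Dom), Z.1 ⊆ X.1 → ∀ t ∈ terms L M Z, ∀ s₀ ∈ Ioc (0 : ℝ) γ,
      Nonempty (SliceInputsL2U (𝔇 k') (χu k') (χcu k') (𝒲 k') (𝒪 k') c Sg Rz cs E₀ κE Z t (Wt k' X) s₀ a a₅ ρb Mv) :=
  fun ιN => absurd (sq_window_lt_half_of_keyedLocatedInputs c P 𝔸 M L 𝔇 χu χcu 𝒲 𝒪 Sg Rz cs E₀ κE a a₅ ρb Mv Wt γ k hk hγ hc0 hcAP hcP1 hMvγ ιN) (not_lt.2 hγ2)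

end KnitLevel

/-! ## §2 Sufficiency: the knit's numerals at `consts` for EVERY window `γ² < ½`, with J17-W's letters `a₅ = 1∕5`, `ρb = 1∕100` and some `Mv > 1` -/

/-- The aperture arithmetic at `δ ∈ ]0, 1∕200]`, `γ² = ½ − 100δ`: `(1−δ)⁻²(1+δ)((1+δ∕2)γ)² ≤ ½`, `2(1−δ)⁻²(1+δ)·2·(1+δ∕2)² ≤ 7`, `δ∕(1−δ) < 1∕100`. [folklore] -/
theorem apertureArith_of_window {γ δ : ℝ} (hδ0 : 0 < δ) (hδ1 : δ ≤ 1 / 200) (hγδ : γ ^ 2 = 1 / 2 - 100 * δ) :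
    (1 - δ)⁻¹ ^ 2 * (1 + δ) * ((1 + δ / 2) * γ) ^ 2 ≤ 1 / 2 ∧ 2 * ((1 - δ)⁻¹ ^ 2 * (1 + δ)) * 2 * (1 + δ / 2) ^ 2 ≤ 7 ∧ δ / (1 - δ) < 1 / 100 := by
  have h1δ : 0 < 1 - δ := by linarith
  have hsq : 0 < (1 - δ) ^ 2 := pow_pos h1δ 2
  have hne : (1 - δ) ^ 2 ≠ 0 := hsq.ne'
  refine ⟨?_, ?_, ?_⟩
  · have key : (1 + δ) * ((1 + δ / 2) * γ) ^ 2 ≤ (1 - δ) ^ 2 * (1 / 2) := by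
      rw [mul_pow, hγδ]
      nlinarith [mul_pos hδ0 hδ0, mul_pos (mul_pos hδ0 hδ0) hδ0, mul_pos (mul_pos hδ0 hδ0) (mul_pos hδ0 hδ0)]
    calc (1 - δ)⁻¹ ^ 2 * (1 + δ) * ((1 + δ / 2) * γ) ^ 2 = ((1 - δ) ^ 2)⁻¹ * ((1 + δ) * ((1 + δ / 2) * γ) ^ 2) := by rw [inv_pow]; ring
      _ ≤ ((1 - δ) ^ 2)⁻¹ * ((1 - δ) ^ 2 * (1 / 2)) := by gcongr
      _ = 1 / 2 := by rw [← mul_assoc, inv_mul_cancel₀ hne, one_mul]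
  · have key : 4 * (1 + δ) * (1 + δ / 2) ^ 2 ≤ (1 - δ) ^ 2 * 7 := by
      nlinarith [mul_pos hδ0 hδ0, mul_pos (mul_pos hδ0 hδ0) hδ0]
    calc 2 * ((1 - δ)⁻¹ ^ 2 * (1 + δ)) * 2 * (1 + δ / 2) ^ 2 = ((1 - δ) ^ 2)⁻¹ * (4 * (1 + δ) * (1 + δ / 2) ^ 2) := by rw [inv_pow]; ring
      _ ≤ ((1 - δ) ^ 2)⁻¹ * ((1 - δ) ^ 2 * 7) := by gcongr
      _ = 7 := by rw [← mul_assoc, inv_mul_cancel₀ hne, one_mul]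
  · rw [div_lt_iff₀ h1δ]
    linarith

/-- **★ THE KNIT's NUMERALS AT THE NUMERICS RECORD OF RECORD, SHARP WINDOW, KEYED ON EXPLICIT LETTERS** — for every bond-cube parameter `M` and EVERY window `γ` with `γ² < ½`
(module J14: `γ ≤ ½`; no sign condition on `γ` is needed for the numerals), AT THE NAMED LETTERS `cP = (½ − γ²)∕100 ∈ ]0, 1∕200]`, `cA = (½ − γ²)∕200`, `Mv = 1 + (½ − γ²)∕100`,
`li = ⟨consts.κ, ½, 0, 0, 0, 1, 7, 1, cA, ½⟩` (binders `hli hcA hcP hMv`, so that a consumer's θ-dependent `li F θ`, `cA F θ`, … instantiate by `rfl`), block factor `consts.L = 8`, socket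
letters `(aw + 40M, 1, 1, 1∕5 + log 2, 1)`, `r₁ = consts.κ`, `E₀ = consts.E₀ = 2`, `c = consts`, `a₅ = 1∕5`, `ρb = 1∕100`: the letter signs, `Lemma3Numerics`, S25, the STRICT [KP86] clause,
the renewal size, the weight slack, the apertures `0 < cA < cP < 1`, `cP∕(1−cP) < ρb < 1`, `0 < Mv`, `1 < Mv`, `(1−cP)⁻²·Mv·((1+cA)γ)² ≤ ½`, `2(1−cP)⁻²Mv·E₀·(1+cA)² ≤ li.A`,
`li.r ≤ min cA 1`, `1 ≤ consts.κ₁`, `consts.α₆ ≠ 0`, W1-8's `0 < invTau consts d ≤ ½` — i.e. EVERY numeric hypothesis of J17-K ∕ J19's `hdata` and BOTH conditions of J17-W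
`locatedAntecedentL2U_inhabited` (which serves every `Mv > 1`), at once, in the conjunct order of module J14.  Key inequality: `(1+cP)(1+cP∕2)²γ² ≤ (1−cP)²∕2` at `γ² = ½ − 100cP`
(`apertureArith_of_window`). [cite: Balaban1988RG2Cluster, (2.15) p.15, (2.24)-(2.26) p.17, Lemma 3 p.20, (2.39)-(2.41) p.21; Balaban1987RG1, §1 p.263, (2.9)-(2.10) pp.266-267] -/
theorem knitNumerals_consts_at_window_keyed (M : ℕ) {γ : ℝ} (hγ2 : γ ^ 2 < 1 / 2) {li : LetterInputs} {cA cP Mv : ℝ}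
    (hli : li = ⟨consts.κ, 1 / 2, 0, 0, 0, 1, 7, 1, (1 / 2 - γ ^ 2) / 200, (2 : ℝ)⁻¹⟩) (hcA : cA = (1 / 2 - γ ^ 2) / 200) (hcP : cP = (1 / 2 - γ ^ 2) / 100)
    (hMv : Mv = 1 + (1 / 2 - γ ^ 2) / 100) :
    (0 < li.C₀ ∧ 0 < li.θ₅ ∧ li.θ₅ < 1 ∧ 0 ≤ li.C₅ ∧ 2 * li.C₅ / (1 - li.θ₅) ≤ li.C₀ ∧ 0 < li.A ∧ li.μ = 1 ∧ 0 < li.r ∧ li.s = (2 : ℝ)⁻¹) ∧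
      8 ≤ consts.L ∧ consts.L = consts.L ∧ Lemma3Numerics consts M ((consts.L : ℝ) / 2) (aw + 40 * (M : ℝ)) 1 1 (1 / 5 + Real.log 2) 1 ∧
      0 ≤ consts.C3act * consts.ε₁ ∧ 0 ≤ consts.κ ∧ li.κ ≤ consts.κ ∧
      consts.κ + 2 * (64 * Real.log 162) + 2 ≤ (1 - 8 * consts.δ) * ((consts.L : ℝ) / 2) * consts.κ ∧
      consts.C3act * consts.ε₁ * Real.exp (5 * consts.κ + 1) * K₀ 64 8 * 9 * 64 < 1 ∧
      Real.exp 1 * 9 * 64 * K₀ 64 8 ^ 2 * (consts.C3act * consts.ε₁) ≤ consts.E₀ ∧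
      (∀ {d n : ℕ} [NeZero n] (Z : TDom d n), 2 * Real.exp ((1 / 5 : ℝ) * ((Z.1).card : ℝ)) ≤ Real.exp ((1 / 5 + Real.log 2) * ((Z.1).card : ℝ))) ∧
      0 < cA ∧ cA < cP ∧ cP < 1 ∧ cP / (1 - cP) < 1 / 100 ∧ (1 / 100 : ℝ) < 1 ∧
      0 < Mv ∧ 1 < Mv ∧ (1 - cP)⁻¹ ^ 2 * Mv * ((1 + cA) * γ) ^ 2 ≤ 1 / 2 ∧
      2 * ((1 - cP)⁻¹ ^ 2 * Mv) * consts.E₀ * (1 + cA) ^ 2 ≤ li.A ∧ li.r ≤ min cA 1 ∧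
      1 ≤ consts.κ₁ ∧ consts.α₆ ≠ 0 ∧ (∀ d : ℝ, 0 ≤ d → 0 < invTau consts d ∧ invTau consts d ≤ 1 / 2) := by
  obtain ⟨hL, -, hC3pos, hκ, hκr, hlarge, -, hrenew⟩ := stripNumerics_consts
  obtain ⟨-, -, -, -, -, -, -, -, -, -, -, -, -, -, -, -, -, -, -, -, -, -, -, -, -, -, -, -, -, -, -, -, -, -, -, -, -, -, -, hκ₁, hinv⟩ :=
    numerics_nonvacuous_pos_consts
  have hE₀ : consts.E₀ = 2 := rfl
  -- the window-dependent aperture letter `δ = cP`, kept opaque behind its equation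
  obtain ⟨δ, hδ⟩ : ∃ δ : ℝ, δ = (1 / 2 - γ ^ 2) / 100 := ⟨_, rfl⟩
  have hδ0 : 0 < δ := by rw [hδ]; linarith
  have hδ1 : δ ≤ 1 / 200 := by rw [hδ]; nlinarith [sq_nonneg γ]
  have hγδ : γ ^ 2 = 1 / 2 - 100 * δ := by rw [hδ]; ring
  have hcA' : cA = δ / 2 := by rw [hcA, hδ]; ring
  have hcP' : cP = δ := by rw [hcP, hδ]
  have hMv' : Mv = 1 + δ := by rw [hMv, hδ]
  have hli' : li = ⟨consts.κ, 1 / 2, 0, 0, 0, 1, 7, 1, δ / 2, (2 : ℝ)⁻¹⟩ := by rw [hli, ← hcA, hcA']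
  rw [hli', hcA', hcP', hMv']
  obtain ⟨hMvγ, hAM, hρb⟩ := apertureArith_of_window hδ0 hδ1 hγδ
  refine ⟨?_, hL, rfl, lemma3Numerics_consts_anyM_fifth M, hC3pos, hκ, hκr, hlarge, smallKP_consts_strict, hrenew, fun Z => two_mul_exp_le_exp_add_log_two (1 / 5) Z,
    half_pos hδ0, by linarith, by linarith, hρb, by norm_num, by linarith, by linarith, hMvγ, ?_, le_min le_rfl (by linarith), hκ₁, consts_α₆_ne_zero, hinv⟩
  · exact ⟨by norm_num, by norm_num, by norm_num, le_rfl, by norm_num, by norm_num, rfl, half_pos hδ0, rfl⟩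
  · show 2 * ((1 - δ)⁻¹ ^ 2 * (1 + δ)) * consts.E₀ * (1 + δ / 2) ^ 2 ≤ 7
    rw [hE₀]; exact hAM

/-- **★ THE KNIT's NUMERALS AT THE NUMERICS RECORD OF RECORD, SHARP WINDOW** (module J14's `∃`-shape) — for every bond-cube parameter `M` and EVERY window `γ` with `γ² < ½` (J14:
`0 < γ ≤ ½`): `∃ li L a a₂ a₂′ a₅′ Aabs r₁ E₀ cA cP Mv`, EVERY numeric hypothesis of J17-K at `c := consts`, `a₅ := 1∕5`, `ρb := 1∕100` ∧ `1 < Mv` ∧ `1 ≤ consts.κ₁` ∧ `consts.α₆ ≠ 0` ∧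
W1-8's `invTau` window — the keyed theorem at its named letters.  With §1: the J-road's numerals ∧ located antecedent are jointly satisfiable at a window `γ > 0` IFF `γ² < ½`.
[cite: Balaban1988RG2Cluster, (2.15) p.15, (2.24)-(2.26) p.17, Lemma 3 p.20, (2.39)-(2.41) p.21; Balaban1987RG1, §1 p.263, (2.9)-(2.10) pp.266-267] -/
theorem knitNumerals_consts_at_window (M : ℕ) {γ : ℝ} (hγ2 : γ ^ 2 < 1 / 2) :
    ∃ (li : LetterInputs) (L : ℕ) (a a₂ a₂' a₅' Aabs r₁ E₀ cA cP Mv : ℝ),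
      (0 < li.C₀ ∧ 0 < li.θ₅ ∧ li.θ₅ < 1 ∧ 0 ≤ li.C₅ ∧ 2 * li.C₅ / (1 - li.θ₅) ≤ li.C₀ ∧ 0 < li.A ∧ li.μ = 1 ∧ 0 < li.r ∧ li.s = (2 : ℝ)⁻¹) ∧
      8 ≤ consts.L ∧ consts.L = L ∧ Lemma3Numerics consts M ((consts.L : ℝ) / 2) a a₂ a₂' a₅' Aabs ∧ 0 ≤ consts.C3act * consts.ε₁ ∧ 0 ≤ r₁ ∧ li.κ ≤ r₁ ∧
      r₁ + 2 * (64 * Real.log 162) + 2 ≤ (1 - 8 * consts.δ) * ((consts.L : ℝ) / 2) * consts.κ ∧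
      consts.C3act * consts.ε₁ * Real.exp (5 * r₁ + 1) * K₀ 64 8 * 9 * 64 < 1 ∧
      Real.exp 1 * 9 * 64 * K₀ 64 8 ^ 2 * (consts.C3act * consts.ε₁) ≤ E₀ ∧
      (∀ {d n : ℕ} [NeZero n] (Z : TDom d n), 2 * Real.exp ((1 / 5 : ℝ) * ((Z.1).card : ℝ)) ≤ Real.exp (a₅' * ((Z.1).card : ℝ))) ∧
      0 < cA ∧ cA < cP ∧ cP < 1 ∧ cP / (1 - cP) < 1 / 100 ∧ (1 / 100 : ℝ) < 1 ∧
      0 < Mv ∧ 1 < Mv ∧ (1 - cP)⁻¹ ^ 2 * Mv * ((1 + cA) * γ) ^ 2 ≤ 1 / 2 ∧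
      2 * ((1 - cP)⁻¹ ^ 2 * Mv) * E₀ * (1 + cA) ^ 2 ≤ li.A ∧ li.r ≤ min cA 1 ∧
      1 ≤ consts.κ₁ ∧ consts.α₆ ≠ 0 ∧ (∀ d : ℝ, 0 ≤ d → 0 < invTau consts d ∧ invTau consts d ≤ 1 / 2) :=
  ⟨_, _, _, _, _, _, _, _, _, _, _, _, knitNumerals_consts_at_window_keyed M hγ2 rfl rfl rfl rfl⟩

/-! ## §3 At a Stage-13 tuple of record: the record's word on the window, and the letters at every admissible tuple with `θ.γ² < ½` -/

section Record

variable {N : ℕ} [NeZero N] {F : T4Family}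

/-- **J14's ∕ J21's regime implies the sharp one**: `0 ≤ γ ≤ ½ ⇒ γ² < ½` (so a consumer typed at the regime `θ.γ ≤ ½` instantiates the keyed numerals too).
[cite: Balaban1987RG1, §1 p.263 (the window; bookkeeping)] -/
theorem sq_window_lt_half_of_le_half {γ : ℝ} (h0 : 0 ≤ γ) (hh : γ ≤ 1 / 2) : γ ^ 2 < 1 / 2 := by
  nlinarith

/-- **THE RECORD's WHOLE WORD ON THE WINDOW OF A STAGE-13 TUPLE**: admissibility gives `0 < θ.γ` (Stage 5, [B16] Thm 1's «interval ]0, γ]») and `θ.γ < 1` (Stage 12's `Pos₁₂`, the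
window inside `]0, 1[`) — and no smaller bound (print: γ «sufficiently small»).  Read off node00-def-T's `Stage13Params.Admissible` ∕ `Stage12Params.Admissible` ∕ … ∕
`Stage5Params.Admissible` by projection. [cite: Balaban1989LargeFieldII, Thm 1 p.355; Balaban1988Convergent, (2.10) p.256; Balaban1987RG1, §1 p.263 (hypothesis dictionary)] -/
theorem stage13_admissible_window (θ : Stage13HParams F N) (hθ : θ.Admissible F N) : 0 < θ.γ ∧ θ.γ < 1 :=
  ⟨hθ.1.1.1.1.1.2, hθ.1.2.2.2.2.2.2⟩

/-- **★ THE KNIT's NUMERALS AT EVERY ADMISSIBLE STAGE-13 TUPLE WITH `θ.γ² < ½`** — `knitNumerals_consts_at_window` at `M := θ.τ9.M`, `γ := θ.γ` (`0 < θ.γ` from admissibility): the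
letters the CoPH port's `hdata` ∕ J17-K's numeral binders ask, per tuple (the letter inputs `li` depend on `θ` through `cA = (½ − θ.γ²)∕200`, as the port's `li F θ` may).  For
admissible tuples with `½ ≤ θ.γ²` (not excluded by `stage13_admissible_window`) see §1: no letters exist once a small-field slice is asked.
[cite: Balaban1988RG2Cluster, (2.15) p.15, (2.24)-(2.26) p.17, Lemma 3 p.20, (2.39)-(2.41) p.21; Balaban1987RG1, §1 p.263, (2.9)-(2.10) pp.266-267] -/
theorem knitNumerals_consts_at_admissible_tuple (θ : Stage13HParams F N) (hθ : θ.Admissible F N) (hγ2 : θ.γ ^ 2 < 1 / 2) :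
    0 < θ.γ ∧ ∃ (li : LetterInputs) (L : ℕ) (a a₂ a₂' a₅' Aabs r₁ E₀ cA cP Mv : ℝ),
      (0 < li.C₀ ∧ 0 < li.θ₅ ∧ li.θ₅ < 1 ∧ 0 ≤ li.C₅ ∧ 2 * li.C₅ / (1 - li.θ₅) ≤ li.C₀ ∧ 0 < li.A ∧ li.μ = 1 ∧ 0 < li.r ∧ li.s = (2 : ℝ)⁻¹) ∧
      8 ≤ consts.L ∧ consts.L = L ∧ Lemma3Numerics consts θ.τ9.M ((consts.L : ℝ) / 2) a a₂ a₂' a₅' Aabs ∧ 0 ≤ consts.C3act * consts.ε₁ ∧ 0 ≤ r₁ ∧ li.κ ≤ r₁ ∧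
      r₁ + 2 * (64 * Real.log 162) + 2 ≤ (1 - 8 * consts.δ) * ((consts.L : ℝ) / 2) * consts.κ ∧
      consts.C3act * consts.ε₁ * Real.exp (5 * r₁ + 1) * K₀ 64 8 * 9 * 64 < 1 ∧
      Real.exp 1 * 9 * 64 * K₀ 64 8 ^ 2 * (consts.C3act * consts.ε₁) ≤ E₀ ∧
      (∀ {d n : ℕ} [NeZero n] (Z : TDom d n), 2 * Real.exp ((1 / 5 : ℝ) * ((Z.1).card : ℝ)) ≤ Real.exp (a₅' * ((Z.1).card : ℝ))) ∧
      0 < cA ∧ cA < cP ∧ cP < 1 ∧ cP / (1 - cP) < 1 / 100 ∧ (1 / 100 : ℝ) < 1 ∧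
      0 < Mv ∧ 1 < Mv ∧ (1 - cP)⁻¹ ^ 2 * Mv * ((1 + cA) * θ.γ) ^ 2 ≤ 1 / 2 ∧
      2 * ((1 - cP)⁻¹ ^ 2 * Mv) * E₀ * (1 + cA) ^ 2 ≤ li.A ∧ li.r ≤ min cA 1 ∧
      1 ≤ consts.κ₁ ∧ consts.α₆ ≠ 0 ∧ (∀ d : ℝ, 0 ≤ d → 0 < invTau consts d ∧ invTau consts d ≤ 1 / 2) :=
  ⟨(stage13_admissible_window θ hθ).1, knitNumerals_consts_at_window θ.τ9.M hγ2⟩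

/-- **THE DICHOTOMY AT A TUPLE OF RECORD, NUMERALS HALF**: at an admissible tuple, aperture letters `0 ≤ cA`, `0 ≤ cP < 1`, `1 < Mv` meeting the knit's `hMvγ` exist IFF
`θ.γ² < ½`. [cite: Balaban1987RG1, §1 p.263; Balaban1988RG2Cluster, (2.24)-(2.26) p.17 (bookkeeping at the letters)] -/
theorem exists_apertureNumeral_iff_sq_window_lt_half (θ : Stage13HParams F N) :
    (∃ cA cP Mv : ℝ, 0 ≤ cA ∧ 0 ≤ cP ∧ cP < 1 ∧ 1 < Mv ∧ (1 - cP)⁻¹ ^ 2 * Mv * ((1 + cA) * θ.γ) ^ 2 ≤ 1 / 2) ↔ θ.γ ^ 2 < 1 / 2 := by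
  refine ⟨fun ⟨cA, cP, Mv, hcA, hcP, hcP1, hMv, h⟩ => sq_lt_half_of_apertureNumeral hMv hcA hcP hcP1 h, fun hγ2 => ?_⟩
  obtain ⟨δ, hδ⟩ : ∃ δ : ℝ, δ = (1 / 2 - θ.γ ^ 2) / 100 := ⟨_, rfl⟩
  have hδ0 : 0 < δ := by rw [hδ]; linarith
  have hδ1 : δ ≤ 1 / 200 := by rw [hδ]; nlinarith [sq_nonneg θ.γ]
  have hγδ : θ.γ ^ 2 = 1 / 2 - 100 * δ := by rw [hδ]; ring
  exact ⟨δ / 2, δ, 1 + δ, by linarith, by linarith, by linarith, by linarith, (apertureArith_of_window hδ0 hδ1 hγδ).1⟩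

end Record

/-! ## §4 (v1.1, APPEND-ONLY — ref-O READ-6 pins) The dichotomy IN THE KNIT's OWN BINDER TYPES: the antecedent core is inhabited iff `γ² < ½`

ERRATUM (ref-O READ-6 NIT-1, prose): in §2, «module J14's `∃`-shape» means J14's CONJUNCT ORDER with the three aperture letters `cA cP Mv` moved under the `∃` — it is
NOT J14's literal type (J14 `knitNumerals_consts_at_jointLetters` pins `cA = 1∕400`, `cP = 1∕200`, `Mv = 3∕2` and asks `0 < γ ≤ ½`); consumers typed on J14's literals keep
J14, consumers at a θ-dependent window use `knitNumerals_consts_at_window_keyed`.  Nothing in §§1–3 is edited.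

WHAT §4 ADDS (imports module J17-W `…SliceInputsL2UWitness` for `locatedAntecedentL2U_inhabited`): the SUFFICIENCY half at the level of J17-K's ∕ J19's binder TYPES, not only of
the numerals — at every window `γ² < ½` the aperture letters of §2 AND the per-slice `Nonempty (SliceInputsL2U …)` binder (thickening `univ`, J17-W's degenerate family at
`c := consts`, `E₀ := consts.E₀`, `κ_E := consts.κ`, `a := aw + 40M`, `a₅ := 1∕5`, `ρb := 1∕100`, `Mv := 1 + (½ − γ²)∕100`) are JOINTLY inhabited, together with W1-11's
unscaled-field law; whence, with §1, the EXACT dichotomy `exists_knitAntecedentCore_iff_sq_window_lt_half`: for a run length `k ≥ 1` and a window `0 < γ`, the knit's antecedent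
CORE (aperture numeral ∧ located inputs, any constants record, any letters, any thickening) is inhabited IFF `γ² < ½`.  DEGENERATE data on the `←` side (J17-W's); bookkeeping.
-/

section Dichotomy

variable (P : Params) (𝔸 : Type*) [NormedRing 𝔸] [NormedAlgebra ℂ 𝔸] [CompleteSpace 𝔸] (M L k : ℕ) [NeZero M] [NeZero L]
  {G : Type*} [GaugeGroup G] (Sg : Setting 𝔸 G) (Rz : Residual P 𝔸) (cs : SFConsts)

/-- **★ A6 FOR §1: THE KNIT's ANTECEDENT CORE IS INHABITED AT EVERY WINDOW `γ² < ½`** — at `c := consts` there are ONE datum family with unscaled data obeying W1-11's law on the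
window `γ` (module J17-W's degenerate family) and the §2 letters `cA = (½ − γ²)∕200 < cP = (½ − γ²)∕100 < 1`, `Mv = 1 + cP > 1` such that the aperture numeral
`(1−cP)⁻²·Mv·((1+cA)γ)² ≤ ½` holds AND `Nonempty (SliceInputsL2U …)` at EVERY slice below ANY run length `k` on the thickening `univ` (J19's `hdata` binder shape, at
`E₀ := consts.E₀`, `κ_E := consts.κ`, `a := aw + 40M`, `a₅ := 1∕5`, `ρb := 1∕100`).  So the hypotheses of `sq_window_lt_half_of_keyedLocatedInputs` are jointly satisfiable
exactly when its conclusion allows.  DEGENERATE data (vanishing potentials, free kernels) — NOT Bałaban's; bookkeeping.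
[cite: Balaban1987RG1, (2.9)-(2.13) pp.266-268; Balaban1988RG2Cluster, (2.3) p.12, (2.14) p.15, (2.22) p.16, (2.24)-(2.26) p.17 (degenerate data; bookkeeping)] -/
theorem keyedLocatedInputs_inhabited_of_sq_lt_half {γ : ℝ} (hγ2 : γ ^ 2 < 1 / 2) :
    ∃ (𝔇 : TermData214 consts P 𝔸 M L) (χu χcu : (k' : ℕ) → (𝔇 k').UnscaledChi) (𝒲 : (k' : ℕ) → (𝔇 k').UnscaledWilson) (𝒪 : (k' : ℕ) → (𝔇 k').UnscaledOlder)
      (cA cP Mv : ℝ), 𝔇.UnscaledFieldLawOn χu χcu 𝒲 𝒪 γ ∧ 0 < cA ∧ cA < cP ∧ cP < 1 ∧ 1 < Mv ∧ (1 - cP)⁻¹ ^ 2 * Mv * ((1 + cA) * γ) ^ 2 ≤ 1 / 2 ∧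
      ∀ k' : ℕ, k' < k → ∀ (X Z : (domSys P M (k' + 1)).Dom), Z.1 ⊆ X.1 → ∀ t ∈ terms L M Z, ∀ s₀ ∈ Ioc (0 : ℝ) γ,
        Nonempty (SliceInputsL2U (𝔇 k') (χu k') (χcu k') (𝒲 k') (𝒪 k') consts Sg Rz cs consts.E₀ consts.κ Z t Set.univ s₀ (aw + 40 * (M : ℝ)) (1 / 5) (1 / 100) Mv) := by
  obtain ⟨-, -, -, -, -, -, -, -, -, -, -, hc0, hcAP, hcP1, -, -, -, hMv1, hMvγ, -, -, hκ₁, -, hinv⟩ :=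
    knitNumerals_consts_at_window_keyed M hγ2 rfl rfl rfl rfl
  have hE₀ : (0 : ℝ) ≤ consts.E₀ := by rw [show consts.E₀ = (2 : ℝ) from rfl]; norm_num
  obtain ⟨𝔇, χu, χcu, 𝒲, 𝒪, hlaw, hN⟩ :=
    locatedAntecedentL2U_inhabited consts P 𝔸 M L hκ₁ hinv Sg Rz cs hE₀ consts.κ hMv1 (aw + 40 * (M : ℝ)) γ
  exact ⟨𝔇, χu, χcu, 𝒲, 𝒪, _, _, _, hlaw, hc0, hcAP, hcP1, hMv1, hMvγ, fun k' _ X Z _ t _ s₀ hs₀ => hN k' Z t s₀ hs₀.1⟩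

/-- **★★ THE DICHOTOMY IN THE KNIT's OWN BINDER TYPES** — for a run length `k ≥ 1` and a window `0 < γ`: there EXIST a constants record `c`, a datum family with unscaled data, letters
`E₀ κ_E a a₅ ρb cA cP Mv`, a thickening `Wt` with the aperture numeral `(1−cP)⁻²·Mv·((1+cA)γ)² ≤ ½` (`0 ≤ cA ≤ cP < 1`) AND the per-slice `Nonempty (SliceInputsL2U …)` binder of
J19 (equivalently J17-K's `ιL2`, by `Classical.choice`) IF AND ONLY IF `γ² < ½`.  `→` = §1 (`sq_window_lt_half_of_keyedLocatedInputs`: the small-field slice forces `Mv > 1`);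
`←` = `keyedLocatedInputs_inhabited_of_sq_lt_half` (J17-W's family at `consts`, §2's letters).  LOCATED «WINDOW-N22-J», sharp form; count-neutral.
[cite: Balaban1987RG1, §1 p.263, (2.9)-(2.13) pp.266-268; Balaban1988RG2Cluster, (2.3) p.12, (2.9) p.14, (2.22) p.16, (2.24)-(2.26) p.17 (bookkeeping at the letters)] -/
theorem exists_knitAntecedentCore_iff_sq_window_lt_half {γ : ℝ} (hγ : 0 < γ) (hk : 1 ≤ k) :
    (∃ (c : B13.Consts) (𝔇 : TermData214 c P 𝔸 M L) (χu χcu : (k' : ℕ) → (𝔇 k').UnscaledChi) (𝒲 : (k' : ℕ) → (𝔇 k').UnscaledWilson)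
        (𝒪 : (k' : ℕ) → (𝔇 k').UnscaledOlder) (E₀ κE a a₅ ρb cA cP Mv : ℝ) (Wt : (k' : ℕ) → (domSys P M (k' + 1)).Dom → Set (CPair P 𝔸)),
        0 ≤ cA ∧ cA ≤ cP ∧ cP < 1 ∧ (1 - cP)⁻¹ ^ 2 * Mv * ((1 + cA) * γ) ^ 2 ≤ 1 / 2 ∧
        ∀ k' : ℕ, k' < k → ∀ (X Z : (domSys P M (k' + 1)).Dom), Z.1 ⊆ X.1 → ∀ t ∈ terms L M Z, ∀ s₀ ∈ Ioc (0 : ℝ) γ,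
          Nonempty (SliceInputsL2U (𝔇 k') (χu k') (χcu k') (𝒲 k') (𝒪 k') c Sg Rz cs E₀ κE Z t (Wt k' X) s₀ a a₅ ρb Mv)) ↔
      γ ^ 2 < 1 / 2 := by
  constructor
  · rintro ⟨c, 𝔇, χu, χcu, 𝒲, 𝒪, E₀, κE, a, a₅, ρb, cA, cP, Mv, Wt, hc0, hcAP, hcP1, hMvγ, ιN⟩
    exact sq_window_lt_half_of_keyedLocatedInputs c P 𝔸 M L 𝔇 χu χcu 𝒲 𝒪 Sg Rz cs E₀ κE a a₅ ρb Mv Wt γ k hk hγ hc0 hcAP hcP1 hMvγ ιN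
  · intro hγ2
    obtain ⟨𝔇, χu, χcu, 𝒲, 𝒪, cA, cP, Mv, -, hc0, hcAP, hcP1, -, hMvγ, hN⟩ :=
      keyedLocatedInputs_inhabited_of_sq_lt_half P 𝔸 M L k Sg Rz cs hγ2
    exact ⟨consts, 𝔇, χu, χcu, 𝒲, 𝒪, consts.E₀, consts.κ, aw + 40 * (M : ℝ), 1 / 5, 1 / 100, cA, cP, Mv, fun _ _ => Set.univ,
      hc0.le, hcAP.le, hcP1, hMvγ, hN⟩

end Dichotomy

end YMDAG.N22.W1

end
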